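import Literature.AlgebraicGeometry.HodgeTheory.MumfordTateGroupExteriorAction
import Literature.AlgebraicGeometry.Deligne1982.WeilTypeCMHodgeGroupLeSU
import Literature.AlgebraicGeometry.Deligne1982.WeilTypeCMGeneralMemberLefschetzGroup
import HarnessLib

/-!
# The Mumford–Tate group of a CM-Weil abelian variety on `H¹`: `MT(A)(ℂ)|_{H¹} ⊆ ℂˣ · SU(φ)(ℂ)` (`=` for the general member), `U(φ)(ℂ) ⊄ MT(A)(ℂ)|_{H¹}`, `S(A)(ℂ) ⊄ MT(A)(ℂ)|_{H¹}`

Milne [Milne2025AbelianMotivesCharP, §1.5 Example 1.17]: for a general polarized abelian variety `(A, ν, λ)` of Weil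
type relative to a CM field `E`, «there is an exact commutative diagram `SU(φ) ↪ MT(A)`, `GU(φ) ↪ L(A)` … It follows
that for a general `A`, the Weil classes are Hodge classes but not Lefschetz classes». Deligne [Deligne1982HodgeCycles,
I §3 Prop. 3.4 and §4, Milne's 2003 endnote 16]: `MT = 𝔾_m · Hg` and, for Weil type, `Hg ⊆ SU(φ)` with equality for
the general member. Milne [Milne1999LefschetzClasses, §1 p. 644, Thm. 4.4]: `S(A)` = the centraliser of `End⁰(A)` in
the unitary group of the polarization, `= ker l(A)` on `L(A)`.

On the tree's carriers, for `(A, η, h)` of Weil type relative to `E = ℚ(η)` (`IsWeilTypeCM A η R e₀ k`, `h` a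
polarization class with the Rosati condition; `MT(A)(ℂ)|_{H¹}` = the image of `HodgeTheory.mumfordTateGroup` under
evaluation in degree `1`), all `theorem`s, no definition, no named fact:
* `MT(A)(ℂ)|_{H¹} ⊆ ℂˣ · SU(φ)(ℂ)` for EVERY member (`Hg ⊆ SU(φ)`, the tree's
  `IsWeilTypeCM.hodgeGroupOne_le_weilSpecialUnitaryGroupCM`, and `MT = w(ℂˣ) · Hg`,
  `HodgeTheory.mem_map_mumfordTateGroup_one_iff`), with EQUALITY for the general member (`HasHodgeGroupSUCM`) — the
  top row of Milne's diagram;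
* **`U(φ)(ℂ) ⊄ ℂˣ · SU(φ)(ℂ)`** (`k ≥ 1`): the diagonal element `w^β ↦ 2w^β`, `w*^β ↦ w*^β/2` of `U(φ)(ℂ)` has
  determinant `2^{2k}` on `W_β` and `2^{-2k}` on `W'_β`, while `c · u'`, `u' ∈ SU(φ)(ℂ)`, has `c^{2k}` on both; hence
  **`U(φ)(ℂ) ⊄ MT(A)(ℂ)|_{H¹}` for every member**, and, for the general member with `k ≥ 2` (where
  `S(A)(ℂ)|_{H¹} = U(φ)(ℂ)`, the tree's `IsWeilTypeCM.unitaryCentralizerGroup_eq_weilUnitaryGroupCM_of_hodgeGroupSU`),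
  **`S(A)(ℂ) ⊄ MT(A)(ℂ)|_{H¹}`** — the bottom row `GU(φ) ≅ L(A)` of Milne's diagram is not reached by `MT(A)` even
  after adjoining the scalars.

## References

* [Milne2025AbelianMotivesCharP] J. S. Milne, *Abelian motives in characteristic p*, arXiv:2508.09972, §1.5 Ex. 1.17.
* [Deligne1982HodgeCycles] P. Deligne (notes by J. S. Milne), LNM 900 (1982), I §3 Prop. 3.4, §4; Milne 2003 endnote 16.
* [Milne1999LefschetzClasses] J. S. Milne, *Lefschetz classes on abelian varieties*, Duke Math. J. 96 (1999), §1 p. 644,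
  Thm. 4.4, Prop. 4.8.
* [vanGeemen1994HodgeAV] B. van Geemen, LNM 1594 (1994), 6.9, Lemma 6.10, Thm. 6.11.
* [Lange2023AbelianVarietiesComplex] H. Lange, *Abelian Varieties over the Complex Numbers* (2023), Rem. 7.2.2 (2).
-/

noncomputable section

open CategoryTheory Polynomial
open Literature.AlgebraicTopology.SingularHomology
open Literature.AlgebraicGeometry.Motives
open Literature.AlgebraicGeometry.HodgeTheory
open Literature.AlgebraicGeometry.VanGeemen1994
open Literature.AlgebraicGeometry.Milne1999

namespace Literature.AlgebraicGeometry.Deligne1982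

variable {A : AbelianVariety ℂ} {η : A ⟶ A} {R : Polynomial ℤ} {e₀ k : ℕ} {h : complexBetti A.X 2}
  {mA : ∀ k : ℕ, complexBetti A.X k ≃ₗ[ℂ] complexBetti A.X k}

/-! ### §1 `MT(A)(ℂ)|_{H¹} ⊆ ℂˣ · SU(φ)(ℂ)`, with equality for the general member -/

/-- **`MT(A)(ℂ)|_{H¹} ⊆ ℂˣ · SU(φ)(ℂ)` for EVERY CM-Weil abelian variety** (`h ∈ B¹(A) ⊗ ℂ`): the degree-one
component of `m ∈ MT(A)(ℂ)` is `c · u` with `c ∈ ℂˣ`, `u ∈ SU(φ)(ℂ)` (`Hg ⊆ SU(φ)`, Deligne (4.4) / Moonen–Zarhin, the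
tree's `IsWeilTypeCM.hodgeGroupOne_le_weilSpecialUnitaryGroupCM`; `MT = 𝔾_m · Hg`).
[cite: Deligne1982HodgeCycles, I Prop. 3.4 and §4 (4.4)] [cite: Lange2023AbelianVarietiesComplex, Rem. 7.2.2 (2)] -/
theorem IsWeilTypeCM.exists_eq_smulOfUnit_mul_of_mem_mumfordTateGroup (hW : IsWeilTypeCM A η R e₀ k)
    (hh : h ∈ hodgeClassSpan A.dim A.X 1) (hm : mA ∈ mumfordTateGroup A.dim A.X) :
    ∃ c : ℂˣ, ∃ u ∈ weilSpecialUnitaryGroupCM A η (R.comp (X ^ 2)) h, mA 1 = LinearEquiv.smulOfUnit c * u := by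
  obtain ⟨c, u', hu', e⟩ := mem_map_mumfordTateGroup_one_iff.1 ⟨mA, hm, rfl⟩
  exact ⟨c, u', hW.hodgeGroupOne_le_weilSpecialUnitaryGroupCM hh hu', e⟩

/-- **`MT(A)(ℂ)|_{H¹} = ℂˣ · SU(φ)(ℂ)` FOR THE GENERAL CM-WEIL ABELIAN VARIETY** (`Hg(A) = SU(φ)`, the tree's
`HasHodgeGroupSUCM`) — the top row `SU(φ) ↪ MT(A)` of Milne's diagram, with cokernel the scalars.
[cite: Milne2025AbelianMotivesCharP, §1.5 Example 1.17] [cite: Deligne1982HodgeCycles, I Prop. 3.4 and Milne 2003 re-edition endnote 16] -/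
theorem mem_map_mumfordTateGroup_one_iff_of_hasHodgeGroupSUCM {P : Polynomial ℤ} (hSU : HasHodgeGroupSUCM A η P h)
    {u : complexBetti A.X 1 ≃ₗ[ℂ] complexBetti A.X 1} :
    u ∈ (mumfordTateGroup A.dim A.X).map
        (Pi.evalMonoidHom (fun k : ℕ ↦ complexBetti A.X k ≃ₗ[ℂ] complexBetti A.X k) 1) ↔
      ∃ c : ℂˣ, ∃ u' ∈ weilSpecialUnitaryGroupCM A η P h, u = LinearEquiv.smulOfUnit c * u' := by
  rw [mem_map_mumfordTateGroup_one_iff, hasHodgeGroupSUCM_iff.1 hSU]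

/-- For the general member, `SU(φ)(ℂ) ≤ MT(A)(ℂ)|_{H¹}`. [cite: Milne2025AbelianMotivesCharP, §1.5 Example 1.17] -/
theorem weilSpecialUnitaryGroupCM_le_map_mumfordTateGroup_of_hasHodgeGroupSUCM {P : Polynomial ℤ}
    (hSU : HasHodgeGroupSUCM A η P h) :
    weilSpecialUnitaryGroupCM A η P h ≤
      (mumfordTateGroup A.dim A.X).map
        (Pi.evalMonoidHom (fun k : ℕ ↦ complexBetti A.X k ≃ₗ[ℂ] complexBetti A.X k) 1) := by
  rw [← hasHodgeGroupSUCM_iff.1 hSU]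
  exact hodgeGroupOne_le_map_mumfordTateGroup

/-! ### §2 `U(φ)(ℂ) ⊄ ℂˣ · SU(φ)(ℂ)`, hence `U(φ)(ℂ) ⊄ MT(A)(ℂ)|_{H¹}` and `S(A)(ℂ) ⊄ MT(A)(ℂ)|_{H¹}` -/

section Scalars

variable (hW : IsWeilTypeCM A η R e₀ k) (hpol : IsPolarizationClass A.dim A.X h) (hRos : IsRosatiCM A η h)

include hW in
/-- `τ_β` is a root of `P_R`. [cite: Deligne1982HodgeCycles, §4 p. 30] -/
private theorem IsWeilTypeCM.cmEmb_isRoot (β : Fin (cmDeg R)) :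
    Polynomial.eval₂ (Int.castRingHom ℂ) (cmEmb R β) (R.comp (X ^ 2)) = 0 := by
  classical
  have hmem : cmEmb R β ∈ cmType R := ((cmType R).equivFin.symm β).2
  have hroot : cmEmb R β ∈ cmRoots R := (Finset.mem_filter.1 hmem).1
  rw [cmRoots, Multiset.mem_toFinset, Polynomial.mem_roots (hW.monic_comp.map (Int.castRingHom ℂ)).ne_zero,
    Polynomial.IsRoot, Polynomial.eval_map] at hroot
  exact hroot

omit hW hpol hRos in
/-- `det(c · u | W_ε) = c^{dim W_ε} · det(u | W_ε)`. [cite: vanGeemen1994HodgeAV, 6.9 and Lemma 6.10] -/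
private theorem detOnEigenspace_smulOfUnit_mul (c : ℂˣ) {u : complexBetti A.X 1 ≃ₗ[ℂ] complexBetti A.X 1}
    {T : Module.End ℂ (complexBetti A.X 1)} (hu : ∀ x, u (T x) = T (u x))
    (hcu : ∀ x, (LinearEquiv.smulOfUnit c * u : complexBetti A.X 1 ≃ₗ[ℂ] complexBetti A.X 1) (T x) =
      T ((LinearEquiv.smulOfUnit c * u : complexBetti A.X 1 ≃ₗ[ℂ] complexBetti A.X 1) x)) (ε : ℂ) :
    detOnEigenspace (LinearEquiv.smulOfUnit c * u) T hcu ε =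
      (c : ℂ) ^ Module.finrank ℂ (T.eigenspace ε) * detOnEigenspace u T hu ε := by
  unfold detOnEigenspace
  have e : ((LinearEquiv.smulOfUnit c * u : complexBetti A.X 1 ≃ₗ[ℂ] complexBetti A.X 1) :
        complexBetti A.X 1 →ₗ[ℂ] complexBetti A.X 1).restrict (mapsTo_eigenspace_of_comm hcu ε) =
      (c : ℂ) • (u : complexBetti A.X 1 →ₗ[ℂ] complexBetti A.X 1).restrict (mapsTo_eigenspace_of_comm hu ε) := by
    ext x
    rw [LinearMap.smul_apply, Submodule.coe_smul, LinearMap.coe_restrict_apply, LinearMap.coe_restrict_apply,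
      LinearEquiv.coe_coe, LinearEquiv.coe_coe, LinearEquiv.mul_apply]
    simp [LinearEquiv.smulOfUnit, Units.smul_def]
  rw [e, LinearMap.det_smul]

include hW hpol hRos in
/-- **`U(φ)(ℂ) ⊄ ℂˣ · SU(φ)(ℂ)`** (`k ≥ 1`): the diagonal element `w^β_i ↦ 2 w^β_i`, `w*^β_i ↦ w*^β_i / 2` (identity
on the other blocks) of `U(φ)(ℂ)` has determinant `2^{2k}` on `W_β` and `2^{-2k}` on `W'_β`, whereas `c · u'` with
`u' ∈ SU(φ)(ℂ)` has determinant `c^{2k}` on both. [cite: vanGeemen1994HodgeAV, 6.9 and Lemma 6.10]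
[cite: Milne2025AbelianMotivesCharP, §1.5 Example 1.17] -/
theorem IsWeilTypeCM.exists_mem_weilUnitaryGroupCM_forall_ne_smulOfUnit_mul :
    ∃ u ∈ weilUnitaryGroupCM A η h, ∀ (c : ℂˣ), ∀ u' ∈ weilSpecialUnitaryGroupCM A η (R.comp (X ^ 2)) h,
      u ≠ LinearEquiv.smulOfUnit c * u' := by
  classical
  set β : Fin (cmDeg R) := ⟨0, hW.cmDeg_pos⟩
  let cc : Fin (cmDeg R) × (Fin (2 * k) × Fin 2) → ℂˣ := fun p =>
    if p.1 = β then (if p.2.2 = 0 then twoU else twoU⁻¹) else 1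
  have hcc : ∀ β' i, (cc (β', i, 0) : ℂ) * cc (β', i, 1) = 1 := by
    intro β' i
    by_cases hβ : β' = β
    · simp [cc, hβ]
    · simp [cc, hβ]
  have hcomm := monoAutoCM_comm hW hpol hRos β 1 cc
  refine ⟨monoAutoCM hW hpol hRos (blockPermCM β 1) cc, monoAutoCM_mem_weilUnitaryGroupCM hW hpol hRos β 1 cc hcc,
    fun c u' hu' heq ↦ ?_⟩
  obtain ⟨hc', -, hdet'⟩ := hu'
  have hcu : ∀ x, (LinearEquiv.smulOfUnit c * u' : complexBetti A.X 1 ≃ₗ[ℂ] complexBetti A.X 1) (pullbackOne A η x) =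
      pullbackOne A η ((LinearEquiv.smulOfUnit c * u' : complexBetti A.X 1 ≃ₗ[ℂ] complexBetti A.X 1) x) :=
    heq ▸ hcomm
  -- determinants of the diagonal element on `W_β` and `W'_β`
  have h0 : detOnEigenspace (monoAutoCM hW hpol hRos (blockPermCM β 1) cc) (pullbackOne A η) hcomm (cmEmb R β) =
      (2 : ℂ) ^ (2 * k) := by
    rw [detOnEigenspace_monoAutoCM_zero hW hpol hRos β 1 cc β]
    simp [cc, twoU, Finset.prod_const, Finset.card_univ, Fintype.card_fin]
  have h1 : detOnEigenspace (monoAutoCM hW hpol hRos (blockPermCM β 1) cc) (pullbackOne A η) hcomm (-cmEmb R β) =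
      ((2 : ℂ) ^ (2 * k))⁻¹ := by
    rw [detOnEigenspace_monoAutoCM_one hW hpol hRos β 1 cc β]
    simp [cc, twoU, Finset.prod_const, Finset.card_univ, Fintype.card_fin]
  -- determinants of `c · u'` on `W_β` and `W'_β`
  have hrt := hW.cmEmb_isRoot β
  have hrt' := hW.neg_root hrt
  have e0 : detOnEigenspace (LinearEquiv.smulOfUnit c * u') (pullbackOne A η) hcu (cmEmb R β) = (c : ℂ) ^ (2 * k) := by
    rw [detOnEigenspace_smulOfUnit_mul c hc' hcu, hdet' _ hrt, mul_one]
    exact congrArg _ (hW.finrank_eig hrt)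
  have e1 : detOnEigenspace (LinearEquiv.smulOfUnit c * u') (pullbackOne A η) hcu (-cmEmb R β) = (c : ℂ) ^ (2 * k) := by
    rw [detOnEigenspace_smulOfUnit_mul c hc' hcu, hdet' _ hrt', mul_one]
    exact congrArg _ (hW.finrank_eig hrt')
  rw [detOnEigenspace_congr heq hcomm hcu, e0] at h0
  rw [detOnEigenspace_congr heq hcomm hcu, e1] at h1
  -- `2^{2k} = 2^{-2k}` is absurd
  have E : (2 : ℂ) ^ (2 * k) = ((2 : ℂ) ^ (2 * k))⁻¹ := h0.symm.trans h1
  have h2k : (2 : ℂ) ^ (2 * k) ≠ 0 := pow_ne_zero _ two_ne_zero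
  have hsq : (2 : ℂ) ^ (2 * k + 2 * k) = 1 := by
    rw [pow_add]
    nth_rw 1 [E]
    exact inv_mul_cancel₀ h2k
  have hnat : (2 : ℕ) ^ (2 * k + 2 * k) = 1 := by exact_mod_cast hsq
  have hk := hW.k_pos
  exact absurd hnat (Nat.one_lt_two_pow (by omega)).ne'

include hW hpol hRos in
/-- **`U(φ)(ℂ) ⊄ MT(A)(ℂ)|_{H¹}` for EVERY CM-Weil abelian variety**: the element of `U(φ)(ℂ)` above is not `c · u'`
with `u' ∈ Hg(A)(ℂ)|_{H¹} ⊆ SU(φ)(ℂ)`. [cite: Milne2025AbelianMotivesCharP, §1.5 Example 1.17]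
[cite: Deligne1982HodgeCycles, I Prop. 3.4 and §4 (4.4)] [cite: vanGeemen1994HodgeAV, 6.9 and Lemma 6.10] -/
theorem IsWeilTypeCM.exists_mem_weilUnitaryGroupCM_not_mem_map_mumfordTateGroup :
    ∃ u ∈ weilUnitaryGroupCM A η h, u ∉ (mumfordTateGroup A.dim A.X).map
      (Pi.evalMonoidHom (fun k : ℕ ↦ complexBetti A.X k ≃ₗ[ℂ] complexBetti A.X k) 1) := by
  obtain ⟨u, hu, hne⟩ := hW.exists_mem_weilUnitaryGroupCM_forall_ne_smulOfUnit_mul hpol hRos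
  refine ⟨u, hu, fun hm ↦ ?_⟩
  obtain ⟨c, u', hu', e⟩ := mem_map_mumfordTateGroup_one_iff.1 hm
  exact hne c u' (hW.hodgeGroupOne_le_weilSpecialUnitaryGroupCM
    (mem_hodgeClassSpan_one_of_isPolarizationClass hW hpol) hu') e

include hW hpol hRos in
/-- **`U(φ)(ℂ) ≰ MT(A)(ℂ)|_{H¹}`** for every CM-Weil abelian variety. [cite: Milne2025AbelianMotivesCharP, §1.5 Example 1.17]
[cite: vanGeemen1994HodgeAV, 6.9 and Lemma 6.10] -/
theorem IsWeilTypeCM.not_weilUnitaryGroupCM_le_map_mumfordTateGroup :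
    ¬ weilUnitaryGroupCM A η h ≤ (mumfordTateGroup A.dim A.X).map
      (Pi.evalMonoidHom (fun k : ℕ ↦ complexBetti A.X k ≃ₗ[ℂ] complexBetti A.X k) 1) := by
  obtain ⟨u, hu, hnot⟩ := hW.exists_mem_weilUnitaryGroupCM_not_mem_map_mumfordTateGroup hpol hRos
  exact fun hle ↦ hnot (hle hu)

include hW hpol hRos in
/-- **`SU(φ)(ℂ) · ℂˣ ≠ U(φ)(ℂ)`: for the general member `MT(A)(ℂ)|_{H¹} ⊊`-type gap — `MT(A)(ℂ)|_{H¹} ≠ U(φ)(ℂ)`**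
(no `c · u'`, `u' ∈ Hg|_{H¹}`, equals the diagonal element). [cite: Milne2025AbelianMotivesCharP, §1.5 Example 1.17] -/
theorem IsWeilTypeCM.map_mumfordTateGroup_ne_weilUnitaryGroupCM :
    (mumfordTateGroup A.dim A.X).map
        (Pi.evalMonoidHom (fun k : ℕ ↦ complexBetti A.X k ≃ₗ[ℂ] complexBetti A.X k) 1) ≠
      weilUnitaryGroupCM A η h :=
  fun heq ↦ hW.not_weilUnitaryGroupCM_le_map_mumfordTateGroup hpol hRos heq.symm.le

include hW hpol hRos in
/-- **`S(A)(ℂ) ⊄ MT(A)(ℂ)|_{H¹}` FOR THE GENERAL CM-WEIL ABELIAN VARIETY** (`Hg(A) = SU(φ)`, `k ≥ 2`): Milne's special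
Lefschetz group read on `H¹` (the centraliser of `End(A)` in the unitary group of `Q_h`, `= U(φ)(ℂ)` for the general
member) is not contained in the Mumford–Tate group even after adjoining the scalars — the bottom row `GU(φ) ≅ L(A)`
of Milne's diagram strictly exceeds the top row `SU(φ) ↪ MT(A)` on `H¹`.
[cite: Milne2025AbelianMotivesCharP, §1.5 Example 1.17] [cite: Milne1999LefschetzClasses, §1 p. 644, Thm. 4.4 and Prop. 4.8] -/
theorem IsWeilTypeCM.not_unitaryCentralizerGroup_le_map_mumfordTateGroup_of_hodgeGroupSU (hk : 2 ≤ k)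
    (hSU : HasHodgeGroupSUCM A η (R.comp (X ^ 2)) h) :
    ¬ unitaryCentralizerGroup A h ≤ (mumfordTateGroup A.dim A.X).map
      (Pi.evalMonoidHom (fun k : ℕ ↦ complexBetti A.X k ≃ₗ[ℂ] complexBetti A.X k) 1) := by
  rw [hW.unitaryCentralizerGroup_eq_weilUnitaryGroupCM_of_hodgeGroupSU hpol hRos hk hSU]
  exact hW.not_weilUnitaryGroupCM_le_map_mumfordTateGroup hpol hRos

include hW hpol hRos in
/-- **The scalar `2 · 1 ∉ U(φ)(ℂ)`**: it does not preserve the non-zero form `Q_h` (`Q_h(2x, 2y) = 4 Q_h(x, y)`; `Q_h`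
is non-degenerate, the tree's `eq_zero_of_forall_polarizationPairingOne_eq_zero'`).
[cite: Deligne1982HodgeCycles, Milne 2003 re-edition endnote 16] [cite: vanGeemen1994HodgeAV, 6.9] -/
theorem IsWeilTypeCM.smulOfUnit_twoU_not_mem_weilUnitaryGroupCM :
    LinearEquiv.smulOfUnit twoU ∉ weilUnitaryGroupCM A η h := by
  classical
  rintro ⟨-, hQ⟩
  have h2 : ∀ x : complexBetti A.X 1, LinearEquiv.smulOfUnit twoU x = (2 : ℂ) • x := fun x ↦ by
    simp [LinearEquiv.smulOfUnit, Units.smul_def, twoU]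
  have hzero : ∀ x y, polarizationPairingOne A.X h (A.dim - 1) x y = 0 := by
    intro x y
    have e := hQ x y
    rw [h2, h2, map_smul, map_smul, LinearMap.smul_apply, smul_smul] at e
    have e3 : ((2 : ℂ) * 2 - 1) • polarizationPairingOne A.X h (A.dim - 1) x y = 0 := by
      rw [sub_smul, one_smul, e, sub_self]
    exact (smul_eq_zero.1 e3).resolve_left (by norm_num)
  set p : Fin (cmDeg R) × (Fin (2 * k) × Fin 2) := (⟨0, hW.cmDeg_pos⟩, ⟨0, by have := hW.k_pos; omega⟩, 0)
  exact (weilBasisι hW hpol hRos).ne_zero p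
    (eq_zero_of_forall_polarizationPairingOne_eq_zero' hpol (by have := hW.two_le_dim; omega) fun x ↦ hzero x _)

include hW hpol hRos in
/-- **Conversely `MT(A)(ℂ)|_{H¹} ⊄ S(A)(ℂ)`**: the scalar `2 · 1 ∈ w(ℂˣ)|_{H¹} ⊆ MT(A)(ℂ)|_{H¹}` is not in Milne's
`S(A)(ℂ)` (the centraliser of `End(A)` in the unitary group of `Q_h`, `≤ U(φ)(ℂ)`) — `MT(A)` meets `L(A)` inside
`GU(φ)`, not inside `U(φ)`. [cite: Milne1999LefschetzClasses, §1 p. 644] [cite: Milne2025AbelianMotivesCharP, §1.5 Example 1.17] -/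
theorem IsWeilTypeCM.smulOfUnit_twoU_not_mem_unitaryCentralizerGroup :
    LinearEquiv.smulOfUnit twoU ∉ unitaryCentralizerGroup A h :=
  fun hu ↦ hW.smulOfUnit_twoU_not_mem_weilUnitaryGroupCM hpol hRos (unitaryCentralizerGroup_le_weilUnitaryGroupCM η h hu)

include hW hpol hRos in
/-- **`MT(A)(ℂ)|_{H¹} ⊄ U(φ)(ℂ)`** (the scalars of modulus `≠ 1`). [cite: Milne2025AbelianMotivesCharP, §1.5 Example 1.17]
[cite: Deligne1982HodgeCycles, I Prop. 3.4 and Milne 2003 re-edition endnote 16] -/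
theorem IsWeilTypeCM.not_map_mumfordTateGroup_le_weilUnitaryGroupCM :
    ¬ (mumfordTateGroup A.dim A.X).map
        (Pi.evalMonoidHom (fun k : ℕ ↦ complexBetti A.X k ≃ₗ[ℂ] complexBetti A.X k) 1) ≤
      weilUnitaryGroupCM A η h :=
  fun hle ↦ hW.smulOfUnit_twoU_not_mem_weilUnitaryGroupCM hpol hRos (hle (smulOfUnit_mem_map_mumfordTateGroup twoU))

include hW hpol hRos in
/-- **`MT(A)(ℂ)|_{H¹} ⊄ S(A)(ℂ)`.** [cite: Milne1999LefschetzClasses, §1 p. 644] [cite: Milne2025AbelianMotivesCharP, §1.5 Example 1.17] -/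
theorem IsWeilTypeCM.not_map_mumfordTateGroup_le_unitaryCentralizerGroup :
    ¬ (mumfordTateGroup A.dim A.X).map
        (Pi.evalMonoidHom (fun k : ℕ ↦ complexBetti A.X k ≃ₗ[ℂ] complexBetti A.X k) 1) ≤
      unitaryCentralizerGroup A h :=
  fun hle ↦ hW.smulOfUnit_twoU_not_mem_unitaryCentralizerGroup hpol hRos
    (hle (smulOfUnit_mem_map_mumfordTateGroup twoU))

end Scalars

end Literature.AlgebraicGeometry.Deligne1982

end
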